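import Summits.PneNP.PneNP.Theorems.SfmBlMachineHat

/-!
# Line «sfm-bl», MACHINE LAYER M4 (typing): the spot families and bad-count tables are polynomial time (stmt-PneNP-20523)

FRONTIER F-N1c; nothing here bears on P vs NP.

`CodeFP` typings of the list functions of `SfmBlMachineHat` (MACHINE-PLAN M4): `codeFP_slegs`,
`codeFP_sublistsC` (capped fold, cap in UNARY in the context so the accumulator is polynomially bounded on
every input, as for M2a `walksC`), `codeFP_connTest` (through M2a `codeFP_walksC`), `codeFP_spotRecs`,
`codeFP_allRecs`, the DP `codeFP_dpStep` / `codeFP_dpTab` (fold over the outputs `0, …, m−1`; accumulator =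
`2C+1` counts `≤ 2^{#steps}`, `foldl_dpStep_le`), `codeFP_badCount`, **`codeFP_hatSum`**.
-/

set_option linter.dupNamespace false -- `Summit.PneNP.PneNP.…`: summit = sub-problem name (D-0017 single-conjunct layout)

namespace Summit.PneNP.PneNP.Theorems.SfmBlMachine

open Literature.Computability.Complexity CodeFP

/-! ## Typing in the `CodeFP` algebra -/

section PolyTime

open Polynomial

/-- Code of a pair record. -/
abbrev precE : PRec → List Bool := pairE natE (pairE natE (rawE plegE))

/-- Code of the hat context `((G, k), (T₀, m))` (`m` in unary). -/
abbrev hctxE : (ℕ × ℕ) × (List Bool × ℕ) → List Bool := pairE (pairE natE natE) (pairE (rawE bitE) unE)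

/-- The legs of a spot are polynomial time (input `((pieced legs, labels), s)`). -/
theorem codeFP_slegs : CodeFP (pairE (pairE (rawE plegE) (rawE natE)) natE) (rawE plegE) (fun p => slegs p.1.1 p.1.2 p.2) := by
  have hp : CodeFP (pairE natE (pairE natE plegE)) bitE (fun t => decide (t.2.1 = t.1 + 1)) :=
    (natEq.comp ((snd _ _).fst'.pair (natAdd.comp ((fst _ _).pair (const _ (1 : ℕ)))))).congr fun _ => rfl
  have hz : CodeFP (pairE (pairE (rawE plegE) (rawE natE)) natE) (rawE (pairE natE plegE)) (fun p => p.1.2.zip p.1.1) :=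
    ((rawZip natE plegE).comp ((fst _ _).snd'.pair (fst _ _).fst')).congr fun _ => rfl
  exact ((map₀ (snd natE plegE)).comp ((filter hp).comp ((snd _ _).pair hz))).congr fun _ => rfl

/-- Left pieces are polynomial time. -/
theorem codeFP_lpieces : CodeFP (rawE plegE) (rawE labE) lpieces :=
  ((dedup labE labE_injective).comp (map₀ codeFP_labL)).congr fun _ => rfl

/-- Right pieces are polynomial time. -/
theorem codeFP_rpieces : CodeFP (rawE plegE) (rawE labE) rpieces :=
  ((dedup labE labE_injective).comp (map₀ codeFP_labR)).congr fun _ => rfl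

/-- One sublist round is polynomial time (input `(cap, (a, acc))`, cap in unary). -/
theorem codeFP_sublStep : CodeFP (pairE unE (pairE labE (rawE (rawE labE)))) (rawE (rawE labE))
    (fun t => sublStep t.1 t.2.2 t.2.1) := by
  have hext : CodeFP (pairE labE (rawE labE)) (rawE labE) (fun q => q.2 ++ [q.1]) :=
    (rawAppend labE).comp ((snd _ _).pair ((rawSingleton labE).comp (fst _ _)))
  have hmap : CodeFP (pairE unE (pairE labE (rawE (rawE labE)))) (rawE (rawE labE))
      (fun t => t.2.2.map fun s => s ++ [t.2.1]) :=
    ((map hext).comp ((snd _ _).fst'.pair (snd _ _).snd')).congr fun _ => rfl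
  exact ((rawTakeUn (rawE labE)).comp ((fst _ _).pair ((rawAppend (rawE labE)).comp ((snd _ _).snd'.pair hmap)))).congr
    fun _ => rfl

/-- **The capped sublist enumeration is polynomial time** (input `(cap, l)`, cap in UNARY). -/
theorem codeFP_sublistsC : CodeFP (pairE unE (rawE labE)) (rawE (rawE labE)) (fun p => sublistsC p.1 p.2) := by
  have h := foldl (σ := ℕ) (α := Lab) (β := List (List Lab)) (eσ := unE) (eα := labE) (eβ := rawE (rawE labE))
    (step := fun cap a acc => sublStep cap acc a) (init := fun _ => [[]]) codeFP_sublStep (const unE [[]])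
    ((X + 1) * (2 * X + 2) + 2) (fun cap l₁ l₂ => by
      set n := (pairE unE (rawE labE) (cap, l₁ ++ l₂)).length with hn
      have hcap : cap ≤ n := by rw [hn]; simp only [pairE_apply, length_boolPair, length_unE]; omega
      have hl : (rawE labE (l₁ ++ l₂)).length ≤ n := by rw [hn]; simp only [pairE_apply, length_boolPair]; omega
      obtain ⟨hsub, hlen⟩ := sublistsC_inv cap l₁ [] [[]] (fun s hs => by simp at hs; simp [hs]) (by simp)
      simp only [List.nil_append] at hsub
      have hitem : ∀ s ∈ l₁.foldl (sublStep cap) [[]], (rawE labE s).length ≤ n := fun s hs =>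
        (length_rawE_le_of_sublist labE ((hsub s hs).trans (List.sublist_append_left l₁ l₂))).trans hl
      have h1 := length_rawE_le_of_forall hitem
      have h2 : (l₁.foldl (sublStep cap) [[]]).length ≤ n + 1 := hlen.trans (by omega)
      have heval : ((X + 1) * (2 * X + 2) + 2 : Polynomial ℕ).eval n = (n + 1) * (2 * n + 2) + 2 := by simp
      show (rawE (rawE labE) (l₁.foldl (fun acc a => sublStep cap acc a) [[]])).length ≤ _
      rw [heval]
      exact h1.trans ((Nat.mul_le_mul_right _ h2).trans (by omega)))
  exact h.congr fun p => rfl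

/-- The inside legs are polynomial time (input `(legs, pair)`). -/
theorem codeFP_legsIn : CodeFP (pairE (rawE plegE) candE) (rawE plegE) (fun p => legsIn p.1 p.2) := by
  have hp : CodeFP (pairE candE plegE) bitE (fun t => decide (labL t.2 ∈ t.1.1) && decide (labR t.2 ∈ t.1.2)) :=
    ((mem labE_injective).comp ((codeFP_labL.comp (snd _ _)).pair (fst _ _).fst')).and
      ((mem labE_injective).comp ((codeFP_labR.comp (snd _ _)).pair (fst _ _).snd'))
  exact ((filter hp).comp ((snd _ _).pair (fst _ _))).congr fun _ => rfl

/-- `meetCount` is polynomial time (input `(legs, pair)`). -/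
theorem codeFP_meetCount : CodeFP (pairE (rawE plegE) candE) natE (fun p => meetCount p.1 p.2) := by
  have hp : CodeFP (pairE candE plegE) bitE (fun t => decide (labL t.2 ∈ t.1.1) || decide (labR t.2 ∈ t.1.2)) :=
    ((mem labE_injective).comp ((codeFP_labL.comp (snd _ _)).pair (fst _ _).fst')).or
      ((mem labE_injective).comp ((codeFP_labR.comp (snd _ _)).pair (fst _ _).snd'))
  exact ((natLength plegE).comp ((filter hp).comp ((snd _ _).pair (fst _ _)))).congr fun _ => rfl

/-- The pair record is polynomial time (input `(legs, pair)`). -/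
theorem codeFP_mkRec : CodeFP (pairE (rawE plegE) candE) precE (fun p => mkRec p.1 p.2) :=
  ((natMul.comp (((natLength labE).comp (snd _ _).fst').pair ((natLength labE).comp (snd _ _).snd'))).pair
    (codeFP_meetCount.pair codeFP_legsIn)).congr fun _ => rfl

/-- **The connectivity test is polynomial time** (input `(cap, (legs, pair))`, cap in unary). -/
theorem codeFP_connTest : CodeFP (pairE unE (pairE (rawE plegE) candE)) bitE (fun p => connTest p.1 p.2.1 p.2.2) := by
  -- the vertex list `W₁ ++ W₂` and its length
  have hS : CodeFP (pairE unE (pairE (rawE plegE) candE)) (rawE labE) (fun p => p.2.2.1 ++ p.2.2.2) :=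
    (rawAppend labE).comp ((snd _ _).snd'.fst'.pair (snd _ _).snd'.snd')
  have hlenN : CodeFP (pairE unE (pairE (rawE plegE) candE)) natE (fun p => (p.2.2.1 ++ p.2.2.2).length) :=
    (natLength labE).comp hS
  have hlenU : CodeFP (pairE unE (pairE (rawE plegE) candE)) unE (fun p => (p.2.2.1 ++ p.2.2.2).length) :=
    (ulength labE).comp hS
  have hone : CodeFP (pairE unE (pairE (rawE plegE) candE)) bitE (fun p => decide ((p.2.2.1 ++ p.2.2.2).length = 1)) :=
    natEq.comp (hlenN.pair (const _ (1 : ℕ)))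
  -- the walk length `2(|S| − 1)` in unary (through the unary bound `2|S|`)
  have hkN : CodeFP (pairE unE (pairE (rawE plegE) candE)) natE (fun p => 2 * ((p.2.2.1 ++ p.2.2.2).length - 1)) :=
    natMul.comp ((const _ (2 : ℕ)).pair (natSub.comp (hlenN.pair (const _ (1 : ℕ)))))
  have hkU : CodeFP (pairE unE (pairE (rawE plegE) candE)) unE (fun p => 2 * ((p.2.2.1 ++ p.2.2.2).length - 1)) :=
    (unOfNatMin.comp (((unMulConst 2).comp hlenU).pair hkN)).congr fun p => by
      show min (2 * ((p.2.2.1 ++ p.2.2.2).length - 1)) (2 * (p.2.2.1 ++ p.2.2.2).length) = _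
      exact min_eq_left (by omega)
  have hu : CodeFP (pairE unE (pairE (rawE plegE) candE)) (rawE unitE)
      (fun p => List.replicate (2 * ((p.2.2.1 ++ p.2.2.2).length - 1)) ()) := replicateUnit.comp hkU
  -- the walks of the inside legs
  have hws : CodeFP (pairE unE (pairE (rawE plegE) candE)) (rawE walkE)
      (fun p => walksC (legsIn p.2.1 p.2.2) p.1 (List.replicate (2 * ((p.2.2.1 ++ p.2.2.2).length - 1)) ())) :=
    (codeFP_walksC.comp (((codeFP_legsIn.comp (snd _ _)).pair (fst _ _)).pair hu)).congr fun _ => rfl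
  -- the covering test
  have hmem : CodeFP (pairE walkE labE) bitE (fun t => decide (t.2 ∈ t.1.2)) :=
    (mem labE_injective).comp ((snd _ _).pair (fst _ _).snd')
  have hcov : CodeFP (pairE (rawE labE) walkE) bitE (fun t => t.1.all fun P => decide (P ∈ t.2.2)) :=
    ((all hmem).comp ((snd _ _).pair (fst _ _))).congr fun _ => rfl
  have hany : CodeFP (pairE unE (pairE (rawE plegE) candE)) bitE
      (fun p => (walksC (legsIn p.2.1 p.2.2) p.1 (List.replicate (2 * ((p.2.2.1 ++ p.2.2.2).length - 1)) ())).any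
        fun w => (p.2.2.1 ++ p.2.2.2).all fun P => decide (P ∈ w.2)) :=
    ((any hcov).comp (hS.pair hws)).congr fun _ => rfl
  exact (hone.or hany).congr fun _ => rfl

/-- The sub-pairs are polynomial time (input `(capS, legs)`, cap in unary). -/
theorem codeFP_subPairs : CodeFP (pairE unE (rawE plegE)) (rawE candE) (fun p => subPairs p.1 p.2) :=
  ((rawProduct (rawE labE) (rawE labE)).comp
    ((codeFP_sublistsC.comp ((fst _ _).pair (codeFP_lpieces.comp (snd _ _)))).pair
      (codeFP_sublistsC.comp ((fst _ _).pair (codeFP_rpieces.comp (snd _ _)))))).congr fun _ => rfl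

/-- The pair records of a spot are polynomial time (input `((capS, capW), legs)`, caps in unary). -/
theorem codeFP_spotRecs : CodeFP (pairE (pairE unE unE) (rawE plegE)) (rawE precE) (fun p => spotRecs p.1.1 p.1.2 p.2) := by
  have hc : CodeFP (pairE (pairE (pairE unE unE) (rawE plegE)) candE) bitE (fun t => connTest t.1.1.2 t.1.2 t.2) :=
    (codeFP_connTest.comp ((fst _ _).fst'.snd'.pair ((fst _ _).snd'.pair (snd _ _)))).congr fun _ => rfl
  have hf : CodeFP (pairE (pairE unE unE) (rawE plegE)) (rawE candE)
      (fun p => (subPairs p.1.1 p.2).filter (connTest p.1.2 p.2)) :=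
    ((filter hc).comp ((CodeFP.id _).pair (codeFP_subPairs.comp ((fst _ _).fst'.pair (snd _ _))))).congr fun _ => rfl
  have hr : CodeFP (pairE (rawE plegE) candE) precE (fun t => mkRec t.1 t.2) := codeFP_mkRec
  exact ((map hr).comp ((snd _ _).pair hf)).congr fun _ => rfl

/-- **The pair records of all spots are polynomial time** (input `((capS, capW), ((pieced legs, labels), r))`,
caps and `r` in unary). -/
theorem codeFP_allRecs : CodeFP (pairE (pairE unE unE) (pairE (pairE (rawE plegE) (rawE natE)) unE)) (rawE precE)
    (fun p => allRecs p.1.1 p.1.2 p.2.1.1 p.2.1.2 p.2.2) := by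
  have hone : CodeFP (pairE (pairE (pairE unE unE) (pairE (pairE (rawE plegE) (rawE natE)) unE)) natE) (rawE precE)
      (fun t => spotRecs t.1.1.1 t.1.1.2 (slegs t.1.2.1.1 t.1.2.1.2 t.2)) :=
    (codeFP_spotRecs.comp ((fst _ _).fst'.pair (codeFP_slegs.comp ((fst _ _).snd'.fst'.pair (snd _ _))))).congr
      fun _ => rfl
  exact ((flatten precE).comp ((map hone).comp ((CodeFP.id _).pair (urange.comp (snd _ _).snd')))).congr fun _ => rfl

/-- `cOut` is polynomial time (input `(legs, j)`). -/
theorem codeFP_cOut : CodeFP (pairE (rawE plegE) natE) natE (fun p => cOut p.1 p.2) := by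
  have hp : CodeFP (pairE natE plegE) bitE (fun t => decide (t.2.1 = t.1)) :=
    natEq.comp ((snd _ _).fst'.pair (fst _ _))
  exact ((natLength plegE).comp ((filter hp).comp ((snd _ _).pair (fst _ _)))).congr fun _ => rfl

/-- `getZ` is polynomial time (input `(table, z)`). -/
theorem codeFP_getZ : CodeFP (pairE (rawE natE) intE) natE (fun p => getZ p.1 p.2) := by
  have hneg : CodeFP (pairE (rawE natE) intE) bitE (fun p => decide (p.2 < 0)) :=
    intLt.comp ((snd _ _).pair (const _ (0 : ℤ)))
  have hget : CodeFP (pairE (rawE natE) intE) natE (fun p => p.1.getD p.2.toNat 0) :=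
    (rawGetOr natE).comp ((fst _ _).pair ((intToNat.comp (snd _ _)).pair (const _ (0 : ℕ))))
  exact (hneg.ite (const _ (0 : ℕ)) hget).congr fun p => by
    unfold getZ
    simp only [decide_eq_true_eq]

/-- Code of the DP context `((k, T₀), legs)`. -/
abbrev dctxE : (ℕ × List Bool) × List PLeg → List Bool := pairE (pairE natE (rawE bitE)) (rawE plegE)

/-- `cSgn` is polynomial time (input `(((k, T₀), legs), j)`). -/
theorem codeFP_cSgn : CodeFP (pairE dctxE natE) intE (fun p => cSgn p.1.1.2 p.1.2 p.2) := by
  have hc : CodeFP (pairE dctxE natE) intE (fun p => (cOut p.1.2 p.2 : ℤ)) :=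
    (intOfNat.comp (codeFP_cOut.comp ((fst _ _).snd'.pair (snd _ _)))).congr fun _ => rfl
  have hb : CodeFP (pairE dctxE natE) bitE (fun p => p.1.1.2.getD p.2 false) :=
    ((rawGetOr bitE).comp ((fst _ _).fst'.snd'.pair ((snd _ _).pair (const _ false)))).congr fun _ => rfl
  exact (hb.ite (intNeg.comp hc) hc).congr fun _ => rfl

/-- One DP entry is polynomial time (input `(((k, T₀), legs), (table, (j, i)))`). -/
theorem codeFP_dpEntry : CodeFP (pairE dctxE (pairE (rawE natE) (pairE natE natE))) natE
    (fun p => dpEntry p.1.1.1 p.1.1.2 p.1.2 p.2.1 p.2.2.1 p.2.2.2) := by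
  have hfix : CodeFP (pairE dctxE (pairE (rawE natE) (pairE natE natE))) bitE (fun p => decide (p.2.2.1 < p.1.1.1)) :=
    (natLt.comp ((snd _ _).snd'.fst'.pair (fst _ _).fst'.fst')).congr fun _ => rfl
  have hi : CodeFP (pairE dctxE (pairE (rawE natE) (pairE natE natE))) intE (fun p => (p.2.2.2 : ℤ)) :=
    (intOfNat.comp (snd _ _).snd'.snd').congr fun _ => rfl
  have hc : CodeFP (pairE dctxE (pairE (rawE natE) (pairE natE natE))) intE (fun p => (cOut p.1.2 p.2.2.1 : ℤ)) :=
    (intOfNat.comp (codeFP_cOut.comp ((fst _ _).snd'.pair (snd _ _).snd'.fst'))).congr fun _ => rfl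
  have hs : CodeFP (pairE dctxE (pairE (rawE natE) (pairE natE natE))) intE (fun p => cSgn p.1.1.2 p.1.2 p.2.2.1) :=
    (codeFP_cSgn.comp ((fst _ _).pair (snd _ _).snd'.fst')).congr fun _ => rfl
  have htab : CodeFP (pairE dctxE (pairE (rawE natE) (pairE natE natE))) (rawE natE) (fun p => p.2.1) := (snd _ _).fst'
  have h1 : CodeFP (pairE dctxE (pairE (rawE natE) (pairE natE natE))) natE
      (fun p => getZ p.2.1 ((p.2.2.2 : ℤ) - cSgn p.1.1.2 p.1.2 p.2.2.1)) :=
    (codeFP_getZ.comp (htab.pair (intSub.comp (hi.pair hs)))).congr fun _ => rfl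
  have h2 : CodeFP (pairE dctxE (pairE (rawE natE) (pairE natE natE))) natE
      (fun p => getZ p.2.1 ((p.2.2.2 : ℤ) - (cOut p.1.2 p.2.2.1 : ℤ)) + getZ p.2.1 ((p.2.2.2 : ℤ) + (cOut p.1.2 p.2.2.1 : ℤ))) :=
    (natAdd.comp ((codeFP_getZ.comp (htab.pair (intSub.comp (hi.pair hc)))).pair
      (codeFP_getZ.comp (htab.pair (intAdd.comp (hi.pair hc)))))).congr fun _ => rfl
  exact (hfix.ite h1 h2).congr fun p => by
    unfold dpEntry
    simp only [decide_eq_true_eq]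

/-- One DP step is polynomial time (input `(((k, T₀), legs), (j, table))`). -/
theorem codeFP_dpStep : CodeFP (pairE dctxE (pairE natE (rawE natE))) (rawE natE)
    (fun p => dpStep p.1.1.1 p.1.1.2 p.1.2 p.2.2 p.2.1) := by
  have he : CodeFP (pairE (pairE dctxE (pairE natE (rawE natE))) natE) natE
      (fun t => dpEntry t.1.1.1.1 t.1.1.1.2 t.1.1.2 t.1.2.2 t.1.2.1 t.2) :=
    (codeFP_dpEntry.comp ((fst _ _).fst'.pair ((fst _ _).snd'.snd'.pair ((fst _ _).snd'.fst'.pair (snd _ _))))).congr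
      fun _ => rfl
  exact ((map he).comp ((CodeFP.id _).pair (urange.comp ((ulength natE).comp (snd _ _).snd')))).congr fun _ => rfl

/-- The initial table is polynomial time. -/
theorem codeFP_dpInit : CodeFP (rawE plegE) (rawE natE) dpInit := by
  have hlen : CodeFP (rawE plegE) unE (fun xs => 2 * xs.length + 1) :=
    (unSucc.comp ((unMulConst 2).comp (ulength plegE))).congr fun _ => rfl
  have he : CodeFP (pairE (rawE plegE) natE) natE (fun t => if t.2 = t.1.length then 1 else 0) :=
    ((natEq.comp ((snd _ _).pair ((natLength plegE).comp (fst _ _)))).ite (const _ (1 : ℕ)) (const _ (0 : ℕ))).congr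
      fun t => by by_cases h : t.2 = t.1.length <;> simp [h]
  exact ((map he).comp ((CodeFP.id _).pair (urange.comp hlen))).congr fun _ => rfl

/-- Bit size of a bounded natural. -/
theorem size_le_of_le_two_pow {x j : ℕ} (h : x ≤ 2 ^ j) : Nat.size x ≤ j + 1 :=
  (size_mono h).trans (by rw [Nat.size_pow])

/-- **The DP table is polynomial time** (input `(((k, T₀), legs), m)`, `m` in unary). -/
theorem codeFP_dpTab : CodeFP (pairE dctxE unE) (rawE natE) (fun p => dpTab p.1.1.1 p.1.1.2 p.1.2 p.2) := by
  have hstep : CodeFP (pairE dctxE (pairE natE (rawE natE))) (rawE natE)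
      (fun t => dpStep t.1.1.1 t.1.1.2 t.1.2 t.2.2 t.2.1) := codeFP_dpStep
  have hinit : CodeFP dctxE (rawE natE) (fun s => dpInit s.2) := codeFP_dpInit.comp (snd _ _)
  have h := foldl (σ := (ℕ × List Bool) × List PLeg) (α := ℕ) (β := List ℕ) (eσ := dctxE) (eα := natE)
    (eβ := rawE natE) (step := fun s j tab => dpStep s.1.1 s.1.2 s.2 tab j) (init := fun s => dpInit s.2) hstep hinit
    ((2 * X + 1) * (2 * X + 4) + 2) (fun s l₁ l₂ => by
      obtain ⟨⟨k, T0⟩, xs⟩ := s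
      set n := (pairE dctxE (rawE natE) (((k, T0), xs), l₁ ++ l₂)).length with hn
      have hxs : xs.length ≤ n := by
        have := length_le_length_rawE plegE xs
        rw [hn]; simp only [pairE_apply, length_boolPair]; omega
      have hl₁ : l₁.length ≤ n := by
        have := length_le_length_rawE natE (l₁ ++ l₂)
        rw [List.length_append] at this
        rw [hn]; simp only [pairE_apply, length_boolPair]; omega
      set tab := l₁.foldl (fun tab j => dpStep k T0 xs tab j) (dpInit xs) with htab
      have hlen : tab.length = 2 * xs.length + 1 := by
        suffices h : ∀ (l : List ℕ) (t : List ℕ), (l.foldl (fun tab j => dpStep k T0 xs tab j) t).length = t.length by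
          rw [htab, h]; simp [dpInit]
        intro l
        induction l with
        | nil => intro t; rfl
        | cons j l ih => intro t; rw [List.foldl_cons, ih, length_dpStep]
      have hent : ∀ x ∈ tab, x ≤ 2 ^ l₁.length * 1 := foldl_dpStep_le k T0 xs l₁ (dpInit xs) 1 (dpInit_le xs)
      have hitem : ∀ x ∈ tab, (natE x).length ≤ n + 1 := fun x hx => by
        rw [length_natE]
        exact (size_le_of_le_two_pow (by simpa using hent x hx)).trans (by omega)
      have h1 := length_rawE_le_of_forall hitem
      have heval : ((2 * X + 1) * (2 * X + 4) + 2 : Polynomial ℕ).eval n = (2 * n + 1) * (2 * n + 4) + 2 := by simp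
      show (rawE natE tab).length ≤ _
      rw [heval]
      rw [hlen] at h1
      have h3 : (2 * xs.length + 1) * (2 * (n + 1) + 2) ≤ (2 * n + 1) * (2 * n + 4) := Nat.mul_le_mul (by omega) (by omega)
      exact h1.trans (h3.trans (by omega)))
  exact (h.comp ((fst _ _).pair (urange.comp (snd _ _)))).congr fun p => rfl

/-- `badIdx` is polynomial time (input `((G, ab), (C, i))`). -/
theorem codeFP_badIdx : CodeFP (pairE (pairE natE natE) (pairE natE natE)) bitE (fun p => badIdx p.1.1 p.1.2 p.2.1 p.2.2) := by
  have hl : CodeFP (pairE (pairE natE natE) (pairE natE natE)) intE (fun p => ((p.1.1 * p.1.2 : ℕ) : ℤ)) :=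
    intOfNat.comp (natMul.comp (fst _ _))
  have hr : CodeFP (pairE (pairE natE natE) (pairE natE natE)) intE (fun p => ((p.2.2 : ℤ) - (p.2.1 : ℤ)) ^ 2) :=
    (intMul.comp ((intSub.comp ((intOfNat.comp (snd _ _).snd').pair (intOfNat.comp (snd _ _).fst'))).pair
      (intSub.comp ((intOfNat.comp (snd _ _).snd').pair (intOfNat.comp (snd _ _).fst'))))).congr fun _ => by ring
  exact (intLt.comp (hl.pair hr)).congr fun p => by simp [badIdx]

/-- **The bad count of a pair record is polynomial time** (input `(((G, k), (T₀, m)), rec)`). -/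
theorem codeFP_badCount : CodeFP (pairE hctxE precE) natE (fun p => badCount p.1.1.1 p.1.1.2 p.1.2.1 p.1.2.2 p.2) := by
  -- the table of the record
  have htab : CodeFP (pairE hctxE precE) (rawE natE) (fun p => dpTab p.1.1.2 p.1.2.1 p.2.2.2 p.1.2.2) :=
    (codeFP_dpTab.comp ((((fst _ _).fst'.snd'.pair (fst _ _).snd'.fst').pair (snd _ _).snd'.snd').pair
      (fst _ _).snd'.snd')).congr fun _ => rfl
  have hC : CodeFP (pairE hctxE precE) unE (fun p => 2 * p.2.2.2.length + 1) :=
    (unSucc.comp ((unMulConst 2).comp ((ulength plegE).comp (snd _ _).snd'.snd'))).congr fun _ => rfl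
  have hz : CodeFP (pairE hctxE precE) (rawE (pairE natE natE))
      (fun p => (List.range (2 * p.2.2.2.length + 1)).zip (dpTab p.1.1.2 p.1.2.1 p.2.2.2 p.1.2.2)) :=
    ((rawZip natE natE).comp ((urange.comp hC).pair htab)).congr fun _ => rfl
  -- the filter
  have hp : CodeFP (pairE (pairE hctxE precE) (pairE natE natE)) bitE
      (fun t => badIdx t.1.1.1.1 t.1.2.1 t.1.2.2.2.length t.2.1) :=
    (codeFP_badIdx.comp ((((fst _ _).fst'.fst'.fst').pair (fst _ _).snd'.fst').pair
      (((natLength plegE).comp (fst _ _).snd'.snd'.snd').pair (snd _ _).fst'))).congr fun _ => rfl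
  exact (natSum.comp ((map₀ (snd natE natE)).comp ((filter hp).comp ((CodeFP.id _).pair hz)))).congr fun _ => rfl

/-- **The machine's hat sum is polynomial time** (input `(((G, k), (T₀, m)), records)`). -/
theorem codeFP_hatSum : CodeFP (pairE hctxE (rawE precE)) natE (fun p => hatSum p.1.1.1 p.1.1.2 p.1.2.1 p.1.2.2 p.2) := by
  have hone : CodeFP (pairE hctxE precE) natE (fun t => t.2.2.1 * badCount t.1.1.1 t.1.1.2 t.1.2.1 t.1.2.2 t.2) :=
    (natMul.comp ((snd _ _).snd'.fst'.pair codeFP_badCount)).congr fun _ => rfl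
  exact (natSum.comp (map hone)).congr fun _ => rfl

end PolyTime

end Summit.PneNP.PneNP.Theorems.SfmBlMachine
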